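import Summits.HodgeConjecture.HodgeConjecture.Theorems.Ring2AbelianAllSpreadCommonFloor
import HarnessLib

/-!
# Ring 2 · §AbelianAll (seat `ab-spread-1`), VII — the PER-CLASS floor FS_∃ᶜ and its FAILURE FORM F_CM: "a rational
# `(p,p)` class on an abelian variety that is NOT algebraic stays non-algebraic at some CM fibre of SOME CM-pointed
# abelian family carrying it" — an exact complement of `HC_CM` with NO named fact on either side

HONEST FRAMING: research route, not a corollary; conditional on HC_CM plus one named minimal statement.
(Cell line: research route conditional on HC_CM; not a corollary; Q11.4-sentence-2 already refuted in dim ≥ 3.)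

Cell `pub-hodge-ring2`, sub-cell `ab-*` (ALL ABELIAN VARIETIES), seat `ab-spread-1`, gen 4; answers REFEREE-AB R-08
F-ab-29 ("the per-class variant of U_∃ is formally weaker and closes the same way — type it or say why not"). `HC_CM` =
`Theses.RankFourFaces.CMAbelianHodge` (stmt-3052) is a BINDER `hCM` wherever used, never a fact; `HC_AV` =
`Theses.PadicSemiregularLift.HodgeAbelianVarieties` (stmt-1333); the item `Theses.RankFourFaces.CMToAbelian`
(stmt-16267) is OPEN and nothing here closes it; nothing here is a case of the Hodge conjecture; the two new nodes are
`@[conjecture]` defs used ONLY as hypotheses. The printed input `deligne1982_cmDenseMumfordTateFamilies` (`hF`,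
Deligne 1982 Prop. 6.1 = Charles–Schnell Thm. 11.5.11) enters ONLY §D/§E, `andre1996_cmAnchoredPencil` (`h₂₁`) only
§D's on-path row of FS_∃ᶜ — never a closing or on-path row of F_CM.

NODES (typed ONCE, at part VI's common floor — count once: the same per-class restriction of U_∃ / CPS_∃, "U_∃ᶜ /
CPS_∃ᶜ", sits between them and FS_∃ᶜ and is not separately typed). §A `IsCMAnchoredDatumFor A p c f n s W` = part VI's
`IsCMAnchoredFamilyFor` with the point `s` and the global class `W` DISPLAYED (CM-pointed abelian family, `W` fibrewise
rational `(p,p)`, `g^*(e₁^*(W|_{𝒳_s})) = q·c`, `q ≠ 0`). §B **FS_∃ᶜ `CMAnchoredFamilyClassSpreading`**: every rational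
`(p,p)` class on an abelian variety has an anchored datum whose lifting class `W`, IF algebraic at every CM fibre, is
algebraic at the anchor (FS_∃ asks this for every fibrewise-Hodge global class at every fibre). **F_CM
`HodgeFailureSpreadsToCMFibre`** (FS_∃ᶜ contraposed, habitats for already-algebraic classes dropped): every
NON-algebraic rational `(p,p)` class on an abelian variety has an anchored datum and a CM fibre at which `W` is NOT
algebraic. KERNEL (§C, NO named fact anywhere): `FS_∃ ⟹ FS_∃ᶜ ⟹ F_CM ⟹ CMToAbelian`; `HC_CM → F_CM → HC_AV`
(`HC_AV_of_HC_CM_and_hodgeFailureSpreadsToCMFibre`, the brief's `HC_AV_of_HC_CM_and_Bmin` with `B_min := F_CM`);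
`HC_AV ⟹ F_CM` vacuously; hence **`HC_AV ↔ (HC_CM ∧ F_CM)` and `ModCM F_CM ↔ CMToAbelian` with NO named fact**.
§D: `F_CM ⟹ FS_∃ᶜ` granted habitats carrying the ALGEBRAIC classes on the nose (`hF`; not derivable from `h₂₁`, whose
6.3.1 datum transports algebraicity toward `A` only), so `F_CM ↔ FS_∃ᶜ` mod `hF`; under `HC_CM` all per-class nodes
are `HC_AV`. WHY THE FACTS DISAPPEAR: in CPS_∃, U_∃, FS_∃ the on-path fact pays only for habitats of classes that are
ALREADY algebraic, which the closing assembly never touches; F_CM quantifies over non-algebraic classes only.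

HONEST COLUMN. (a) Fact-free exactness is NOT depth: the item has it trivially (Frame I `exactWithCM_cmToAbelian`).
§E makes the gap kernel-precise: the closing row of F_CM never uses the anchoring clause; the UNANCHORED shadow
("`¬HC_AV ⟹` some CM-pointed abelian family has a fibrewise-Hodge global class failing at a CM fibre") implies the
item fact-free AND follows from it granted `hF` (`¬HC_CM` gives a non-algebraic Hodge class on a CM `B`, sitting at the
CM fibre `s₁` of Deligne's family through `(B, c')`): `unanchoredCMFailure_iff_cmToAbelian_of_deligne1982`. So the
ENTIRE content of F_CM beyond `CMToAbelian` is the anchoring clause — the CM failure sits on the SAME flat section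
that carries `c`, in a family through an isogeny image of `A` (for `A` simple without CM factor `Hom(A, A₁) ⊗ ℚ = 0` for
CM `A₁`, so no constant CM family is anchored for `c ≠ 0`). No edge `CMToAbelian ⟹ F_CM` is known or claimed.
(b) KIND by PREMISE: F_CM / FS_∃ᶜ carry the "EVERY CM fibre" premise ⟹ KIND 2, complementary; `HC_CM` NOT idle; no
`CMIdle` row exists or is claimed. (c) "Minimal" NOT claimed (F-ab-4): F_CM is the weakest TYPED geometric node of
the spread/pencil axes only formally; the least sufficient complement remains the item. (d) Vacuity: F_CM is vacuous
iff `HC_AV`; its conclusion is not free (non-empty CM locus, irreducible smooth base, `q ≠ 0`). (e) No print locator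
states FS_∃ᶜ or F_CM (searched: corpus fts + vec, galaxy; SPREAD.md §12); nearest print: Deligne Thm. 2.12 /
Principle B, Charles–Schnell Conj. 11.3.1 / Prop. 11.3.11, Abdulali (1.1), André §6.3 a).

References (bib keys): Andre1996Motifs (Lemme 6.3.1 p. 31, §6.3 a) p. 33); Deligne1982HodgeCycles (Prop. 6.1,
Thm. 2.12, Prop. 2.9, §6 pp. 71–73); CharlesSchnell2014Notes (Thm. 11.5.11, Conj. 11.3.1, Prop. 11.3.11, Cor. 11.3.6);
Abdulali1994FamiliesAV ((1.1), Lemma 6.2); Milne1999 (§7 hypothesis (H)).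
-/

set_option linter.dupNamespace false

noncomputable section

namespace Summit.HodgeConjecture.HodgeConjecture.Ring2.AbelianAll

open CategoryTheory AlgebraicGeometry
open Literature.AlgebraicGeometry Literature.AlgebraicGeometry.Motives
open Literature.AlgebraicGeometry.HodgeTheory
open Literature.AlgebraicGeometry.Milne1999 (IsOfCMType)
open Literature.AlgebraicGeometry.Andre1996 (andre1996_cmAnchoredPencil)
open Literature.AlgebraicGeometry.Deligne1982 (deligne1982_cmDenseMumfordTateFamilies IsCMDenseMumfordTateFamilyFor)
open Summit.HodgeConjecture.HodgeConjecture
open Summit.HodgeConjecture.HodgeConjecture.Theses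
open Summit.HodgeConjecture.HodgeConjecture.Theses.RankFourFaces (CMAbelianHodge CMToAbelian)
open Summit.HodgeConjecture.HodgeConjecture.Theses.PadicSemiregularLift (HodgeAbelianVarieties)
open Summit.HodgeConjecture.HodgeConjecture.Ring2.Deform (cmLocus CMSpreadingTo CMAnchoredPencilCMSpreading
  forall_cmLocus_mem_algebraicClasses_of_HC_CM)
open Summit.HodgeConjecture.HodgeConjecture.Theorems.HodgeAbelianVarieties.Negative (iff_hodgeConjecture_restricted)

variable {𝒳 S : SchemeOver ℂ}


/-! ## §A The anchored datum (part VI's anchoring with the point and the global class DISPLAYED) -/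

/-- **An ANCHORED DATUM for `(A, p, c)`**: a CM-pointed abelian family `f : 𝒳 ⟶ S` of relative dimension `n` (part VI
`IsCMPointedAbelianFamily`), a point `s ∈ S(ℂ)` and a global class `W ∈ H^{2p}(𝒳(ℂ); ℂ)` with fibrewise rational
`(p,p)` restrictions, carrying `c` at `s` in the form of André's Lemme 6.3.1 (iii): `g^*(e₁^*(W|_{𝒳_s})) = q·c`, `q ≠ 0`.
Exactly part VI's `IsCMAnchoredFamilyFor A p c f n` with `s`, `W` displayed. A predicate; nothing is asserted.
[cite: Andre1996Motifs, Lemme 6.3.1 (i)(iii) (p. 31)] [cite: Deligne1982HodgeCycles, Prop. 6.1 (a)(b) (p. 71)] -/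
def IsCMAnchoredDatumFor (A : AbelianVariety ℂ) (p : ℕ) (c : complexBetti A.X (2 * p)) (f : 𝒳 ⟶ S) (n : ℕ)
    (s : ComplexPoints S) (W : complexBetti 𝒳 (2 * p)) : Prop :=
  IsCMPointedAbelianFamily f n ∧
    (∀ s' : ComplexPoints S, IsRationalClass (complexBetti.map (fiberι f s') (2 * p) W) ∧
        IsOfHodgeType n (fiberOver f s') (2 * p) p p (complexBetti.map (fiberι f s') (2 * p) W)) ∧
    ∃ (A₁ : AbelianVariety ℂ) (e₁ : A₁.X ≅ fiberOver f s) (g : A ⟶ A₁) (q : ℚ), q ≠ 0 ∧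
      complexBetti.map g.hom.hom.hom (2 * p)
          (complexBetti.map e₁.hom (2 * p) (complexBetti.map (fiberι f s) (2 * p) W)) = (q : ℂ) • c

/-- Part VI's anchoring predicate is "some anchored datum". [folklore] -/
theorem isCMAnchoredFamilyFor_iff_exists_datum {A : AbelianVariety ℂ} {p : ℕ} {c : complexBetti A.X (2 * p)}
    {f : 𝒳 ⟶ S} {n : ℕ} :
    IsCMAnchoredFamilyFor A p c f n ↔
      ∃ (s : ComplexPoints S) (W : complexBetti 𝒳 (2 * p)), IsCMAnchoredDatumFor A p c f n s W :=
  ⟨fun ⟨hfam, s, W, A₁, e₁, g, q, hW, hq, hgc⟩ ↦ ⟨s, W, hfam, hW, A₁, e₁, g, q, hq, hgc⟩,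
    fun ⟨s, W, hfam, hW, A₁, e₁, g, q, hq, hgc⟩ ↦ ⟨hfam, s, W, A₁, e₁, g, q, hW, hq, hgc⟩⟩

/-- **The anchor transports algebraicity back to `A`**: if `W|_{𝒳_s}` is algebraic then so is `c` (across `e₁`, back
along `g` by `map_mem_algebraicClasses_of_abelianVariety`, divide by `q ≠ 0`). [cite: Andre1996Motifs, §6.3 a) (p. 33)] -/
theorem mem_algebraicClasses_of_isCMAnchoredDatumFor {A : AbelianVariety ℂ} (hA : IsSmoothProjective A.dim A.X)
    {p : ℕ} {c : complexBetti A.X (2 * p)} {f : 𝒳 ⟶ S} {n : ℕ} {s : ComplexPoints S} {W : complexBetti 𝒳 (2 * p)}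
    (h : IsCMAnchoredDatumFor A p c f n s W)
    (hs : complexBetti.map (fiberι f s) (2 * p) W ∈ algebraicClasses (fiberOver f s) p) :
    c ∈ algebraicClasses A.X p := by
  obtain ⟨_, _, A₁, e₁, g, q, hq, hgc⟩ := h
  have h₃ : (q : ℂ) • c ∈ algebraicClasses A.X p := by
    rw [← hgc]
    exact map_mem_algebraicClasses_of_abelianVariety hA A₁ g.hom.hom.hom
      ((mem_algebraicClasses_map_iff_of_iso e₁).2 hs)
  exact (Submodule.smul_mem_iff _ (Rat.cast_ne_zero.2 hq)).1 h₃

/-- On an anchored datum, `HC_CM` makes `W` algebraic at EVERY CM fibre (deform II-b; the only way `hCM` is ever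
consumed on this axis). [cite: Milne1999, §7 p. 72 (hypothesis (H))] -/
theorem forall_cmLocus_mem_algebraicClasses_of_HC_CM_of_isCMAnchoredDatumFor (hCM : CMAbelianHodge)
    {A : AbelianVariety ℂ} {p : ℕ} {c : complexBetti A.X (2 * p)} {f : 𝒳 ⟶ S} {n : ℕ} {s : ComplexPoints S}
    {W : complexBetti 𝒳 (2 * p)} (h : IsCMAnchoredDatumFor A p c f n s W) :
    ∀ s' ∈ cmLocus f n, complexBetti.map (fiberι f s') (2 * p) W ∈ algebraicClasses (fiberOver f s') p :=
  forall_cmLocus_mem_algebraicClasses_of_HC_CM hCM f W h.2.1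

/-- **Deligne's Mumford–Tate family is an anchored datum carrying `c` ON THE NOSE** (`A₁ = A`, `g = 𝟙`, `q = 1`), so it
transports algebraicity in BOTH directions between `c` and `W|_{𝒳_{s₁}}`. [cite: CharlesSchnell2014Notes, Thm. 11.5.11
(a)(b) (p. 516)] [cite: Deligne1982HodgeCycles, Prop. 6.1 (a)(b) (p. 71)] -/
theorem exists_datum_of_isCMDenseMumfordTateFamilyFor {A : AbelianVariety ℂ} {p : ℕ} {c : complexBetti A.X (2 * p)}
    {f : 𝒳 ⟶ S} (h : IsCMDenseMumfordTateFamilyFor A p c f) :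
    ∃ (s : ComplexPoints S) (W : complexBetti 𝒳 (2 * p)), IsCMAnchoredDatumFor A p c f A.dim s W ∧
      (c ∈ algebraicClasses A.X p → complexBetti.map (fiberι f s) (2 * p) W ∈ algebraicClasses (fiberOver f s) p) := by
  have hne : (cmLocus f A.dim).Nonempty := h.cmLocus_nonempty
  obtain ⟨s₁, e, W, hf, h𝒳, hS, hirr, hsm, hab, hW, hWc, _⟩ := h
  refine ⟨s₁, W, ⟨⟨hf, h𝒳, hS, hirr, hsm, hab, hne⟩, hW, A, e, 𝟙 A, 1, one_ne_zero, ?_⟩, fun hca ↦ ?_⟩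
  · rw [hWc, Rat.cast_one, one_smul]
    exact abelianVariety_map_id_apply c
  · rw [← hWc] at hca
    exact (mem_algebraicClasses_map_iff_of_iso e).1 hca

/-! ## §B The two nodes -/

/-- **FS_∃ᶜ — CM-SPREADING FOR THE LIFTING CLASS ALONG SOME CM-POINTED ABELIAN FAMILY, PER HODGE CLASS** (per-class
floor; REFEREE-AB F-ab-29). For every complex abelian variety `A`, every `p` and every rational `(p,p)` class `c` on
`A` there is an anchored datum `(f, s, W)` for `(A, p, c)` (§A) such that: if `W` is algebraic at EVERY CM fibre of
`f`, then `W` is algebraic at the anchor fibre `𝒳_s`. Part VI's FS_∃ with the spreading clause restricted to the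
lifting class at the anchor. Implied fact-free by FS_∃ (hence CPS_∃, U_∃); with `HC_CM` it gives `HC_AV` with NO
named fact; on path granted `h₂₁ ∨ hF`. OPEN; no print locator of its own; a HYPOTHESIS wherever used; never
asserted; "minimal" not claimed (F-ab-4). [cite: Andre1996Motifs, Lemme 6.3.1 (p. 31) and §6.3 a) (p. 33)]
[cite: CharlesSchnell2014Notes, Thm. 11.5.11 and Prop. 11.3.11] [cite: Deligne1982HodgeCycles, Prop. 6.1] [status: open] -/
@[conjecture] def CMAnchoredFamilyClassSpreading : Prop :=
  ∀ (A : AbelianVariety ℂ), IsSmoothProjective A.dim A.X →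
    ∀ (p : ℕ) (c : complexBetti A.X (2 * p)), IsRationalClass c → IsOfHodgeType A.dim A.X (2 * p) p p c →
      ∃ (n : ℕ) (𝒳 S : SchemeOver ℂ) (f : 𝒳 ⟶ S) (s : ComplexPoints S) (W : complexBetti 𝒳 (2 * p)),
        IsCMAnchoredDatumFor A p c f n s W ∧
          ((∀ s' ∈ cmLocus f n, complexBetti.map (fiberι f s') (2 * p) W ∈ algebraicClasses (fiberOver f s') p) →
            complexBetti.map (fiberι f s) (2 * p) W ∈ algebraicClasses (fiberOver f s) p)

/-- **F_CM — HODGE FAILURES ON ABELIAN VARIETIES SPREAD TO CM FIBRES** (failure form of the per-class floor). For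
every complex abelian variety `A`, every `p` and every rational `(p,p)` class `c` on `A` which is NOT algebraic, there
are an anchored datum `(f, s, W)` for `(A, p, c)` (§A: CM-pointed abelian family over a smooth irreducible
quasi-projective base, `W` fibrewise rational `(p,p)`, `g^*(e₁^*(W|_{𝒳_s})) = q·c`, `q ≠ 0`) and a CM fibre
`s' ∈ cmLocus f n` at which `W` is NOT algebraic: no counterexample to Hodge on an abelian variety is invisible at all
CM fibres of all CM-pointed families carrying it. KERNEL (§C): `HC_AV ↔ HC_CM ∧ F_CM` with NO named fact;
`FS_∃ᶜ ⟹ F_CM`; `F_CM ⟹ FS_∃ᶜ` mod `hF` (§D); its unanchored shadow is `CMToAbelian` mod `hF` (§E). OPEN; no print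
locator of its own; a HYPOTHESIS wherever used; never asserted; "minimal" not claimed (F-ab-4).
[cite: Deligne1982HodgeCycles, Prop. 6.1, Thm. 2.12 and Prop. 2.9] [cite: CharlesSchnell2014Notes, Conj. 11.3.1 and
Prop. 11.3.11] [cite: Andre1996Motifs, Lemme 6.3.1 (p. 31)] [status: open] -/
@[conjecture] def HodgeFailureSpreadsToCMFibre : Prop :=
  ∀ (A : AbelianVariety ℂ), IsSmoothProjective A.dim A.X →
    ∀ (p : ℕ) (c : complexBetti A.X (2 * p)), IsRationalClass c → IsOfHodgeType A.dim A.X (2 * p) p p c →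
      c ∉ algebraicClasses A.X p →
        ∃ (n : ℕ) (𝒳 S : SchemeOver ℂ) (f : 𝒳 ⟶ S) (s : ComplexPoints S) (W : complexBetti 𝒳 (2 * p)),
          IsCMAnchoredDatumFor A p c f n s W ∧
            ∃ s' ∈ cmLocus f n, complexBetti.map (fiberι f s') (2 * p) W ∉ algebraicClasses (fiberOver f s') p

/-! ## §C Fact-free edges and rows -/

/-- **FS_∃ ⟹ FS_∃ᶜ**, NO fact: forget the other global classes and the other fibres. [folklore] -/
theorem cmAnchoredFamilyClassSpreading_of_cmAnchoredFamilyCMSpreading (h : CMAnchoredFamilyCMSpreading) :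
    CMAnchoredFamilyClassSpreading := by
  intro A hA p c hc hpp
  obtain ⟨n, 𝒳, S, f, hanch, hS⟩ := h A hA p c hc hpp
  obtain ⟨s, W, hd⟩ := isCMAnchoredFamilyFor_iff_exists_datum.1 hanch
  exact ⟨n, 𝒳, S, f, s, W, hd, fun hcm ↦ hS s p W hd.2.1 hcm⟩

/-- **FS_∃ᶜ ⟹ F_CM**, NO fact: if the lifting class were algebraic at every CM fibre it would be algebraic at the anchor,
hence `c` would be algebraic (§A). [cite: Andre1996Motifs, §6.3 a) (p. 33)] -/
theorem hodgeFailureSpreadsToCMFibre_of_cmAnchoredFamilyClassSpreading (h : CMAnchoredFamilyClassSpreading) :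
    HodgeFailureSpreadsToCMFibre := by
  intro A hA p c hc hpp hnc
  obtain ⟨n, 𝒳, S, f, s, W, hd, himp⟩ := h A hA p c hc hpp
  refine ⟨n, 𝒳, S, f, s, W, hd, ?_⟩
  by_contra hall
  push Not at hall
  exact hnc (mem_algebraicClasses_of_isCMAnchoredDatumFor hA hd (himp hall))

/-- **FS_∃ ⟹ F_CM**, NO fact (composite; hence CPS_∃, U_∃, FS_CM, `AbelianSchemeVHC` ⟹ F_CM by part VI §B). [folklore] -/
theorem hodgeFailureSpreadsToCMFibre_of_cmAnchoredFamilyCMSpreading (h : CMAnchoredFamilyCMSpreading) :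
    HodgeFailureSpreadsToCMFibre :=
  hodgeFailureSpreadsToCMFibre_of_cmAnchoredFamilyClassSpreading
    (cmAnchoredFamilyClassSpreading_of_cmAnchoredFamilyCMSpreading h)

/-- **`HC_CM ∧ F_CM ⟹` Hodge for every complex abelian variety — NO named fact.** A rational `(p,p)` class `c` on `A` is
algebraic: otherwise F_CM gives an anchored datum and a CM fibre `s'` with `W|_{𝒳_{s'}}` NOT algebraic, while `HC_CM`
makes `W` algebraic at every CM fibre — contradiction. The anchoring clause is not used.
[cite: Milne1999, §7 p. 72 (hypothesis (H))] [cite: Deligne1982HodgeCycles, §6 proof of Thm. 2.11 (pp. 71–73)] -/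
theorem hodgeConjecture_abelian_of_HC_CM_of_hodgeFailureSpreadsToCMFibre (hCM : CMAbelianHodge)
    (h : HodgeFailureSpreadsToCMFibre) :
    ∀ A : AbelianVariety ℂ, IsSmoothProjective A.dim A.X → HodgeConjectureFor A.dim A.X := by
  intro A hA
  refine (hodgeConjectureFor_iff_of_isSmoothProjective nonempty_hodgeModel_holds hA).2 ?_
  intro p c hc hpp
  by_contra hnc
  obtain ⟨n, 𝒳, S, f, s, W, hd, s', hs', hns'⟩ := h A hA p c hc hpp hnc
  exact hns' (forall_cmLocus_mem_algebraicClasses_of_HC_CM_of_isCMAnchoredDatumFor hCM hd s' hs')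

/-- **`HC_AV_of_HC_CM_and_hodgeFailureSpreadsToCMFibre` — the brief's `HC_AV_of_HC_CM_and_Bmin` with `B_min := F_CM` and
EXACTLY two hypotheses**: `HC_CM → F_CM → HC_AV`, NO named fact. [cite: Deligne1982HodgeCycles, §6 (pp. 71–73)] -/
theorem HC_AV_of_HC_CM_and_hodgeFailureSpreadsToCMFibre (hCM : CMAbelianHodge) (h : HodgeFailureSpreadsToCMFibre) :
    HodgeAbelianVarieties :=
  iff_hodgeConjecture_restricted.2 (hodgeConjecture_abelian_of_HC_CM_of_hodgeFailureSpreadsToCMFibre hCM h)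

/-- **`HC_CM ∧ FS_∃ᶜ ⟹ HC_AV`**, NO named fact (through F_CM). [cite: Andre1996Motifs, §6.3 a) (p. 33)] -/
theorem HC_AV_of_HC_CM_and_cmAnchoredFamilyClassSpreading (hCM : CMAbelianHodge)
    (h : CMAnchoredFamilyClassSpreading) : HodgeAbelianVarieties :=
  HC_AV_of_HC_CM_and_hodgeFailureSpreadsToCMFibre hCM (hodgeFailureSpreadsToCMFibre_of_cmAnchoredFamilyClassSpreading h)

/-- F_CM closes with `HC_CM`, NO fact (LEAD grammar). [folklore] -/
theorem closesWithCM_hodgeFailureSpreadsToCMFibre : ClosesWithCM HodgeFailureSpreadsToCMFibre :=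
  fun hCM h ↦ HC_AV_of_HC_CM_and_hodgeFailureSpreadsToCMFibre hCM h

/-- FS_∃ᶜ closes with `HC_CM`, NO fact (LEAD grammar). [folklore] -/
theorem closesWithCM_cmAnchoredFamilyClassSpreading : ClosesWithCM CMAnchoredFamilyClassSpreading :=
  fun hCM h ↦ HC_AV_of_HC_CM_and_cmAnchoredFamilyClassSpreading hCM h

/-- Hence `F_CM ⟹ CMToAbelian` and `FS_∃ᶜ ⟹ CMToAbelian` outright (typed conditionals TOWARD stmt-HodgeConjecture-16267,
which stays OPEN). [folklore] -/
theorem cmToAbelian_of_perClassFloor :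
    (HodgeFailureSpreadsToCMFibre → CMToAbelian) ∧ (CMAnchoredFamilyClassSpreading → CMToAbelian) :=
  ⟨cmToAbelian_of_closesWithCM closesWithCM_hodgeFailureSpreadsToCMFibre,
    cmToAbelian_of_closesWithCM closesWithCM_cmAnchoredFamilyClassSpreading⟩

/-- **ON-PATH with NO fact: `HC_AV ⟹ F_CM`** — under `HC_AV` every rational `(p,p)` class on an abelian variety is
algebraic, so nothing triggers F_CM. [folklore] -/
theorem onPathAV_hodgeFailureSpreadsToCMFibre : OnPathAV HodgeFailureSpreadsToCMFibre :=
  fun hAV A _ p c hc hpp hnc ↦ absurd ((hAV A).2 p c hc hpp) hnc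

/-- **EXACTNESS with NO named fact: `HC_AV ↔ (HC_CM ∧ F_CM)`** — apart from the item `CMToAbelian` itself (Frame I
`exactWithCM_cmToAbelian`), the first exact complement of `HC_CM` in the sub-cell both of whose brackets are empty.
In print `HC_CM` is NOT known to follow from F_CM (KIND 2). [folklore] -/
theorem exactWithCM_hodgeFailureSpreadsToCMFibre : ExactWithCM HodgeFailureSpreadsToCMFibre :=
  exactWithCM_iff.2 ⟨closesWithCM_hodgeFailureSpreadsToCMFibre, onPathAV_hodgeFailureSpreadsToCMFibre⟩

/-- The same, unfolded: `HC_AV ↔ (HC_CM ∧ F_CM)`, NO named fact. [folklore] -/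
theorem HC_AV_iff_HC_CM_and_hodgeFailureSpreadsToCMFibre :
    HodgeAbelianVarieties ↔ (CMAbelianHodge ∧ HodgeFailureSpreadsToCMFibre) :=
  exactWithCM_hodgeFailureSpreadsToCMFibre

/-- Relativised to `HC_CM`, the failure form IS the item: `ModCM F_CM ↔ CMToAbelian`, NO named fact. [folklore] -/
theorem modCM_hodgeFailureSpreadsToCMFibre_iff_cmToAbelian : ModCM HodgeFailureSpreadsToCMFibre ↔ CMToAbelian :=
  modCM_iff_cmToAbelian_of_exactWithCM exactWithCM_hodgeFailureSpreadsToCMFibre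

/-- Under `HC_CM` alone (no print), `F_CM ↔ HC_AV`. [folklore] -/
theorem hodgeFailureSpreadsToCMFibre_iff_HC_AV_of_HC_CM (hCM : CMAbelianHodge) :
    HodgeFailureSpreadsToCMFibre ↔ HodgeAbelianVarieties :=
  iff_HC_AV_of_exactWithCM_of_HC_CM exactWithCM_hodgeFailureSpreadsToCMFibre hCM

/-- ON-PATH from the summit, NO fact. [folklore] -/
theorem hodgeFailureSpreadsToCMFibre_of_hodgeConjecture (hHC : _root_.HodgeConjecture) :
    HodgeFailureSpreadsToCMFibre :=
  of_onPathAV_of_hodgeConjecture onPathAV_hodgeFailureSpreadsToCMFibre hHC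

/-! ## §D The per-class floor versus its failure form: habitats for the algebraic classes -/

/-- **F_CM ⟹ FS_∃ᶜ granted ALGEBRAICALLY-ANCHORED HABITATS for the algebraic classes** — the only thing the failure form
does not supply, and only for classes ALREADY algebraic: an anchored datum with `W|_{𝒳_s}` algebraic (a habitat carrying
`c` ON THE NOSE qualifies, `exists_datum_of_isCMDenseMumfordTateFamilyFor`; a 6.3.1 pencil datum does not).
[cite: CharlesSchnell2014Notes, Thm. 11.5.11] [cite: Andre1996Motifs, Lemme 6.3.1 (p. 31)] -/
theorem cmAnchoredFamilyClassSpreading_of_habitats_of_hodgeFailureSpreadsToCMFibre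
    (hH : ∀ (A : AbelianVariety ℂ), IsSmoothProjective A.dim A.X →
      ∀ (p : ℕ) (c : complexBetti A.X (2 * p)), IsRationalClass c → IsOfHodgeType A.dim A.X (2 * p) p p c →
        c ∈ algebraicClasses A.X p →
          ∃ (n : ℕ) (𝒳 S : SchemeOver ℂ) (f : 𝒳 ⟶ S) (s : ComplexPoints S) (W : complexBetti 𝒳 (2 * p)),
            IsCMAnchoredDatumFor A p c f n s W ∧
              complexBetti.map (fiberι f s) (2 * p) W ∈ algebraicClasses (fiberOver f s) p)
    (h : HodgeFailureSpreadsToCMFibre) : CMAnchoredFamilyClassSpreading := by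
  intro A hA p c hc hpp
  by_cases hca : c ∈ algebraicClasses A.X p
  · obtain ⟨n, 𝒳, S, f, s, W, hd, hWs⟩ := hH A hA p c hc hpp hca
    exact ⟨n, 𝒳, S, f, s, W, hd, fun _ ↦ hWs⟩
  · obtain ⟨n, 𝒳, S, f, s, W, hd, s', hs', hns'⟩ := h A hA p c hc hpp hca
    exact ⟨n, 𝒳, S, f, s, W, hd, fun hall ↦ absurd (hall s' hs') hns'⟩

/-- **F_CM ⟹ FS_∃ᶜ granted Deligne's family fact** (the Mumford–Tate family through `(A, c)` carries `c` on the nose).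
[cite: Deligne1982HodgeCycles, Prop. 6.1 (p. 71)] [cite: CharlesSchnell2014Notes, Thm. 11.5.11 (p. 516)] -/
theorem cmAnchoredFamilyClassSpreading_of_deligne1982_of_hodgeFailureSpreadsToCMFibre
    (hF : deligne1982_cmDenseMumfordTateFamilies) (h : HodgeFailureSpreadsToCMFibre) :
    CMAnchoredFamilyClassSpreading := by
  refine cmAnchoredFamilyClassSpreading_of_habitats_of_hodgeFailureSpreadsToCMFibre (fun A hA p c hc hpp hca ↦ ?_) h
  obtain ⟨𝒳, S, f, hfam⟩ := hF A hA p c hc hpp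
  obtain ⟨s, W, hd, halg⟩ := exists_datum_of_isCMDenseMumfordTateFamilyFor hfam
  exact ⟨A.dim, 𝒳, S, f, s, W, hd, halg hca⟩

/-- **`F_CM ↔ FS_∃ᶜ` granted Deligne's family fact** (fact-free in the direction FS_∃ᶜ ⟹ F_CM).
[cite: Deligne1982HodgeCycles, Prop. 6.1 (p. 71)] -/
theorem hodgeFailureSpreadsToCMFibre_iff_cmAnchoredFamilyClassSpreading_of_deligne1982
    (hF : deligne1982_cmDenseMumfordTateFamilies) :
    HodgeFailureSpreadsToCMFibre ↔ CMAnchoredFamilyClassSpreading :=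
  ⟨cmAnchoredFamilyClassSpreading_of_deligne1982_of_hodgeFailureSpreadsToCMFibre hF,
    hodgeFailureSpreadsToCMFibre_of_cmAnchoredFamilyClassSpreading⟩

/-- ON-PATH for FS_∃ᶜ granted EITHER carrier fact (through part VI's FS_∃). [cite: Andre1996Motifs, Lemme 6.3.1]
[cite: Deligne1982HodgeCycles, Prop. 6.1] -/
theorem onPathAV_cmAnchoredFamilyClassSpreading_of_or
    (h : andre1996_cmAnchoredPencil ∨ deligne1982_cmDenseMumfordTateFamilies) :
    OnPathAV CMAnchoredFamilyClassSpreading :=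
  onPathAV_monotone cmAnchoredFamilyClassSpreading_of_cmAnchoredFamilyCMSpreading
    (onPathAV_cmAnchoredFamilyCMSpreading_of_or h)

/-- `ExactWithCM FS_∃ᶜ` modulo `h₂₁ ∨ hF` (the fact on the on-path side only). [cite: CharlesSchnell2014Notes, Cor. 11.3.6] -/
theorem exactWithCM_cmAnchoredFamilyClassSpreading_of_or
    (h : andre1996_cmAnchoredPencil ∨ deligne1982_cmDenseMumfordTateFamilies) :
    ExactWithCM CMAnchoredFamilyClassSpreading :=
  exactWithCM_iff.2 ⟨closesWithCM_cmAnchoredFamilyClassSpreading, onPathAV_cmAnchoredFamilyClassSpreading_of_or h⟩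

/-- **Collapse modulo `HC_CM`**: under `HC_CM`, `F_CM ↔ FS_∃ᶜ ↔ FS_∃` granted `h₂₁ ∨ hF` (each side is then `HC_AV`).
WITHOUT `HC_CM` only the displayed one-way edges and §D's `hF`-iff are known. [cite: CharlesSchnell2014Notes, Cor. 11.3.6] -/
theorem perClassFloor_collapse_of_HC_CM
    (h : andre1996_cmAnchoredPencil ∨ deligne1982_cmDenseMumfordTateFamilies) (hCM : CMAbelianHodge) :
    (HodgeFailureSpreadsToCMFibre ↔ CMAnchoredFamilyClassSpreading) ∧
      (CMAnchoredFamilyClassSpreading ↔ CMAnchoredFamilyCMSpreading) :=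
  ⟨iff_of_exactWithCM_of_HC_CM exactWithCM_hodgeFailureSpreadsToCMFibre
      (exactWithCM_cmAnchoredFamilyClassSpreading_of_or h) hCM,
    iff_of_exactWithCM_of_HC_CM (exactWithCM_cmAnchoredFamilyClassSpreading_of_or h)
      (exactWithCM_cmAnchoredFamilyCMSpreading_of_or h) hCM⟩

/-! ## §E What separates F_CM from the item: the anchoring clause (the unanchored shadow is `CMToAbelian` mod `hF`) -/

/-- **The UNANCHORED shadow of F_CM implies the item**, NO fact: if every failure of `HC_AV` comes with SOME CM-pointed
abelian family carrying a fibrewise rational `(p,p)` global class NOT algebraic at a CM fibre (no relation to the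
failing class asked), then `HC_CM → HC_AV`. This is all the closing row of F_CM uses (F_CM trivially implies its
shadow: a failure of `HC_AV` is a non-algebraic rational `(p,p)` class on some abelian variety). [folklore] -/
theorem cmToAbelian_of_unanchoredCMFailure
    (h : ¬ HodgeAbelianVarieties →
      ∃ (n p : ℕ) (𝒳 S : SchemeOver ℂ) (f : 𝒳 ⟶ S) (W : complexBetti 𝒳 (2 * p)),
        IsCMPointedAbelianFamily f n ∧
          (∀ s' : ComplexPoints S, IsRationalClass (complexBetti.map (fiberι f s') (2 * p) W) ∧
            IsOfHodgeType n (fiberOver f s') (2 * p) p p (complexBetti.map (fiberι f s') (2 * p) W)) ∧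
          ∃ s' ∈ cmLocus f n, complexBetti.map (fiberι f s') (2 * p) W ∉ algebraicClasses (fiberOver f s') p) :
    CMToAbelian := by
  refine cmToAbelian_of_closesWithCM (B := True) (fun hCM _ ↦ ?_) trivial
  by_contra hAV
  obtain ⟨n, p, 𝒳, S, f, W, _, hW, s', hs', hns'⟩ := h hAV
  exact hns' (forall_cmLocus_mem_algebraicClasses_of_HC_CM hCM f W hW s' hs')

/-- **The item implies the unanchored shadow, granted Deligne's family fact**: if `HC_CM → HC_AV` and `HC_AV` fails then
`HC_CM` fails, i.e. some CM abelian variety `B` carries a non-algebraic rational `(p,p)` class `c'`; Deligne's CM-dense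
Mumford–Tate family through `(B, c')` is CM-pointed and its lifting class `W` fails at the CM fibre `𝒳_{s₁} ≅ B`.
[cite: Deligne1982HodgeCycles, Prop. 6.1 (p. 71)] [cite: CharlesSchnell2014Notes, Thm. 11.5.11 (p. 516)] -/
theorem unanchoredCMFailure_of_deligne1982_of_cmToAbelian (hF : deligne1982_cmDenseMumfordTateFamilies)
    (hT : CMToAbelian) (hAV : ¬ HodgeAbelianVarieties) :
    ∃ (n p : ℕ) (𝒳 S : SchemeOver ℂ) (f : 𝒳 ⟶ S) (W : complexBetti 𝒳 (2 * p)),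
      IsCMPointedAbelianFamily f n ∧
        (∀ s' : ComplexPoints S, IsRationalClass (complexBetti.map (fiberι f s') (2 * p) W) ∧
          IsOfHodgeType n (fiberOver f s') (2 * p) p p (complexBetti.map (fiberι f s') (2 * p) W)) ∧
        ∃ s' ∈ cmLocus f n, complexBetti.map (fiberι f s') (2 * p) W ∉ algebraicClasses (fiberOver f s') p := by
  have hnCM : ¬ CMAbelianHodge := fun hCM ↦ hAV (iff_hodgeConjecture_restricted.2 (hT hCM))
  unfold CMAbelianHodge at hnCM
  push Not at hnCM
  obtain ⟨B, hB, hBcm, hnB⟩ := hnCM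
  rw [hodgeConjectureFor_iff_of_isSmoothProjective nonempty_hodgeModel_holds hB] at hnB
  push Not at hnB
  obtain ⟨p, c', hc', hpp', hnc'⟩ := hnB
  obtain ⟨𝒳, S, f, hfam⟩ := hF B hB p c' hc' hpp'
  have hne : (cmLocus f B.dim).Nonempty := hfam.cmLocus_nonempty
  obtain ⟨s₁, e, W, hf, h𝒳, hS, hirr, hsm, hab, hW, hWc, _⟩ := hfam
  refine ⟨B.dim, p, 𝒳, S, f, W, ⟨hf, h𝒳, hS, hirr, hsm, hab, hne⟩, hW, s₁, ⟨B, ⟨e⟩, rfl, hBcm⟩, fun hWs ↦ hnc' ?_⟩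
  rw [← hWc]
  exact (mem_algebraicClasses_map_iff_of_iso e).2 hWs

/-- **Modulo `hF` the unanchored shadow IS the item** — so the whole content of F_CM beyond `CMToAbelian` is the
anchoring clause `g^*(e₁^*(W|_{𝒳_s})) = q·c` (the CM failure sits on the flat section carrying `c`, in a family through an
isogeny image of `A`); no edge `CMToAbelian ⟹ F_CM` is known or claimed. [cite: Deligne1982HodgeCycles, Prop. 6.1 (p. 71)] -/
theorem unanchoredCMFailure_iff_cmToAbelian_of_deligne1982 (hF : deligne1982_cmDenseMumfordTateFamilies) :
    (¬ HodgeAbelianVarieties →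
      ∃ (n p : ℕ) (𝒳 S : SchemeOver ℂ) (f : 𝒳 ⟶ S) (W : complexBetti 𝒳 (2 * p)),
        IsCMPointedAbelianFamily f n ∧
          (∀ s' : ComplexPoints S, IsRationalClass (complexBetti.map (fiberι f s') (2 * p) W) ∧
            IsOfHodgeType n (fiberOver f s') (2 * p) p p (complexBetti.map (fiberι f s') (2 * p) W)) ∧
          ∃ s' ∈ cmLocus f n, complexBetti.map (fiberι f s') (2 * p) W ∉ algebraicClasses (fiberOver f s') p) ↔
      CMToAbelian :=
  ⟨cmToAbelian_of_unanchoredCMFailure, unanchoredCMFailure_of_deligne1982_of_cmToAbelian hF⟩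


end Summit.HodgeConjecture.HodgeConjecture.Ring2.AbelianAll

end
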